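import Literature.RingTheory.MvPolynomial.HilbertFunctionPolynomialExtension
import Mathlib.Algebra.Polynomial.FieldDivision
import Mathlib.RingTheory.Polynomial.Quotient
import Mathlib.RingTheory.Ideal.Quotient.Operations
import Mathlib.RingTheory.Ideal.Maximal
import Mathlib.RingTheory.PrincipalIdealDomain

/-!
# `PairwiseCurvedTilingsLC` (crux stmt-MatrixMultiplication-17883), line `LonelyTranslates` (c1):
adjoining one bound coordinate to a chart keeps the chart ideal maximal

Helper stub `stub_chartIdeal_succ_isMaximal` of the chart induction (`stub_openPiece`) in the
skeleton `Cruxes/PairwiseCurvedTilingsLC/Lines/LonelyTranslates.lean`.  Pure commutative algebra.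

Let `F` be a field, `R = F[w_1, …, w_k] = MvPolynomial (Fin k) F`, `I ⊆ R` a maximal ideal (so
`T = R ⧸ I` is a field) and `q ∈ R[X]` a polynomial whose reduction `q̄ = q.map (mk I) ∈ T[X]` is
irreducible.  Identify `F[w_0, w_1, …, w_k] = MvPolynomial (Fin (k+1)) F` with `R[X]` through
`e = MvPolynomial.finSuccEquiv F k` (`X 0 ↦ X`, `X (Fin.succ j) ↦ C (X j)`).  Then the ideal
`I' = (q, I) ⊆ F[w_0, …, w_k]`, precisely `span (insert (e.symm q) (rename Fin.succ '' I))`, is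
maximal (`stub_chartIdeal_succ_isMaximal`).

Proof.  `e.symm ∘ C = rename Fin.succ` (`Literature.RingTheory.MvPolynomial.coe_rename_succ_eq`),
so `I' = e.symm (span {q} ⊔ I·R[X])`, and `span {q} ⊔ I·R[X]` is the preimage of `span {q̄} ⊆ T[X]`
under the coefficient reduction `R[X] → T[X]` (`comap_mapRingHom_span_map_singleton`, from
`Ideal.comap_map_of_surjective` and `Polynomial.ker_mapRingHom`).  As `T[X]` is a principal ideal
domain and `q̄` is irreducible, `span {q̄}` is maximal (`PrincipalIdealRing.isMaximal_of_irreducible`);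
preimages of maximal ideals under surjections are maximal (`Ideal.comap_isMaximal_of_surjective`),
and so are images under ring isomorphisms (`Ideal.map_isMaximal_of_equiv`).
Elementary, sorry-free, def-free.
-/

set_option linter.dupNamespace false  -- `Summit.<S>.<S>.…` is the mandated namespace

namespace Summit.MatrixMultiplication.MatrixMultiplication.Theorems.PairwiseCurvedTilingsLC.Negative

/-- For the coefficient reduction `π = Polynomial.mapRingHom (Ideal.Quotient.mk I) : R[X] → (R⧸I)[X]`
(a surjection with kernel `I·R[X] = I.map C`), the preimage of the principal ideal generated by
the reduction `q.map (mk I)` of `q ∈ R[X]` is `span {q} ⊔ I.map C`. [folklore] -/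
theorem comap_mapRingHom_span_map_singleton {R : Type} [CommRing R] (I : Ideal R)
    (q : Polynomial R) :
    Ideal.comap (Polynomial.mapRingHom (Ideal.Quotient.mk I))
        (Ideal.span {q.map (Ideal.Quotient.mk I)}) =
      Ideal.span {q} ⊔ I.map (Polynomial.C : R →+* Polynomial R) := by
  have hπ : Function.Surjective (Polynomial.mapRingHom (Ideal.Quotient.mk I)) :=
    Polynomial.map_surjective _ Ideal.Quotient.mk_surjective
  change Ideal.comap (Polynomial.mapRingHom (Ideal.Quotient.mk I))
      (Ideal.span {Polynomial.mapRingHom (Ideal.Quotient.mk I) q}) = _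
  rw [← Set.image_singleton (f := ⇑(Polynomial.mapRingHom (Ideal.Quotient.mk I))),
    ← Ideal.map_span, Ideal.comap_map_of_surjective _ hπ, ← RingHom.ker_eq_comap_bot,
    Polynomial.ker_mapRingHom, Ideal.mk_ker]

/-- STUB `stub_chartIdeal_succ_isMaximal` (chart induction, line `LonelyTranslates` c1): for a
maximal ideal `I` of `F[w_1, …, w_k]` and `q ∈ F[w][X]` with irreducible reduction modulo `I`, the
ideal `(q, I)` of `F[w_0, w_1, …, w_k]` — the new variable `w_0 = X 0` playing the role of `X` via
`MvPolynomial.finSuccEquiv`, the old `w_j` becoming `X (Fin.succ j)` — is maximal.  It is the image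
under the ring isomorphism `(finSuccEquiv F k).symm` of the preimage of the maximal ideal
`span {q.map (mk I)}` of the principal ideal domain `(F[w] ⧸ I)[X]` under the surjective coefficient
reduction `F[w][X] → (F[w] ⧸ I)[X]`. [folklore] -/
theorem stub_chartIdeal_succ_isMaximal {F : Type} [Field F] {k : ℕ}
    (I : Ideal (MvPolynomial (Fin k) F)) [I.IsMaximal]
    (q : Polynomial (MvPolynomial (Fin k) F))
    (hq : Irreducible (q.map (Ideal.Quotient.mk I))) :
    (Ideal.span (insert ((MvPolynomial.finSuccEquiv F k).symm q)
      ((MvPolynomial.rename Fin.succ) '' (I : Set (MvPolynomial (Fin k) F))))).IsMaximal := by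
  letI : Field (MvPolynomial (Fin k) F ⧸ I) := Ideal.Quotient.field I
  haveI hmax : (Ideal.span {q.map (Ideal.Quotient.mk I)}).IsMaximal :=
    PrincipalIdealRing.isMaximal_of_irreducible hq
  haveI hJ : (Ideal.span {q} ⊔ I.map (Polynomial.C :
      MvPolynomial (Fin k) F →+* Polynomial (MvPolynomial (Fin k) F))).IsMaximal := by
    rw [← comap_mapRingHom_span_map_singleton]
    exact Ideal.comap_isMaximal_of_surjective _
      (Polynomial.map_surjective _ Ideal.Quotient.mk_surjective)
  have key : Ideal.span (insert ((MvPolynomial.finSuccEquiv F k).symm q)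
      ((MvPolynomial.rename Fin.succ) '' (I : Set (MvPolynomial (Fin k) F)))) =
      Ideal.map (MvPolynomial.finSuccEquiv F k).symm (Ideal.span {q} ⊔ I.map (Polynomial.C :
        MvPolynomial (Fin k) F →+* Polynomial (MvPolynomial (Fin k) F))) := by
    rw [Ideal.map_sup, Ideal.map_span, Set.image_singleton, Ideal.span_insert]
    congr 1
    change Ideal.map (MvPolynomial.rename Fin.succ) I = _
    rw [← Ideal.map_coe (MvPolynomial.rename Fin.succ),
      Literature.RingTheory.MvPolynomial.coe_rename_succ_eq, ← Ideal.map_map, Ideal.map_coe]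
  rw [key]
  infer_instance

end Summit.MatrixMultiplication.MatrixMultiplication.Theorems.PairwiseCurvedTilingsLC.Negative
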